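import Literature.MathematicalPhysics.QuantumFieldTheory.Balaban1983to89.B9Eq349FlatQGKernel

/-!
# `Balaban1983to89.B9Eq349FlatQGGQInvKernel` — T. Bałaban, *Propagators for lattice gauge theories in a background field*, Commun. Math. Phys. **99** (1985)
# 389–434 [Balaban1985BackgroundPropagators] (3.25) p. 394 at `U ≡ 1` (the factor `(Q′G′²Q′*)⁻¹`), with [Balaban1984PropagatorsI] (1.44)–(1.45) pp. 25–26:
# **THE FLAT KERNEL OF THE CHAIN's `(Q̃′G′(1)²Q̃′†)⁻¹` — the `greenK` of `B9Eq325ProjFormula.RofU_eq_formula_one` — IS b05∕pv17's (1.45)-INVERSE TORUS KERNEL: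
# `((Q̃′G′(1)²Q̃′†)⁻¹ψ)(y) = Σ_{y′} (σ⁻¹·torusKernel145M(L, a, m; ŷ − ŷ′))•ψ(y′)`, `σ = (c₀∕c₁)ρ²L^{d+1}`, AND IT DECAYS IN `tdist` AT pv17's STRIP RATE** — route R2′
# STEP B8′ of the pub-balaban NE9 chain, road B8″ S1 (the flat dictionary), THIRD of its three kernels (`c = (Q̃′G′²Q̃′†)⁻¹`)

statement-level skeleton of published theorems with citation tags; proofs where landed; nothing here is a claim about the Yang–Mills mass gap

CITATION HEADER (lean-in-tree rule).  Audit cell `pub-balaban`, sub-cell `t4`, BINDER row NE9; filed by NE9 formalisation-swarm LEAF PROVER 06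
(`b2b-balaban-t4-ne9-formalise-leaf-06`, gen 68), sequel of `B9Eq349FlatDGQKernel` ∕ `B9Eq349FlatQGKernel` (same seat; road B8″ of `t4/ROUTES-NE9.md` v13.37 ADDENDUM
(ii), t4-ne9-idea-1 gen 100).  The two halves joined are IN THE TREE and used BY NAME: b05's operator identity `B5QGGQ145Torus.qggq_conv_torusKernel145M` («pv17's
kernel IS the kernel of the operator `(Q′_kG′_k²Q′_k^*)^{−1}`»: `Σ_{y′∈T₁} (Q′G′²Q′^*)(y,y′)·torusKernel145M(y′ − y″) = δ^{T₁}(y − y″)`, with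
`qggq n a 0 N y y′ = ξ^{d+1}Σ_{z∈T_ξ} conj K_T(z,y)·K_T(z,y′)`) and pv17's decay `B5Torus145Decay.inverse145_torusKernelM_decay_torusMetric` (constants `d, a₋, a₊`
only, uniform in `k` and the volume), against the chain's CONSTRUCTED inverse `B11Eq103H1Complex.greenK` (`apply_greenK`, `greenK_apply`).  Sources READ:
[Balaban1985BackgroundPropagators] p. 394 in the held text (`paper:balaban1985-cmp99-background-propagators`); [B5′] pp. 25–26 through the cell's audited headers
(`B5QGGQ145Torus`, `B5Torus145Decay`, `B5Strip145`).

THE PRINT (verbatim).  [B5′] p. 25: *«Now all the operators appearing in these formulas are well defined. We have to verify it only for (Q′_kG′_k²Q′_k^*)^{−1}. …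
We have bounds 0 < Q′_kG′_k²Q′_k^* ≦ a^{−2}, and they imply the existence of the inverse operator and a bound from below.»*; p. 26 (1.45) (the multiplier);
p. 38: *«… the representation (1.45) and the analyticity method of proving an exponential decay»*.  Nothing of print's estimates is asserted; the decay used is
pv17's kernel-checked one with the cell's crude strip constant.

WHAT IS PROVED (sorry-free; proof lane — no `def`; [folklore] kernel bookkeeping; dimension `d+1` as J-M-α ∕ b04).  Letters: `ρ = (ηL)²c₁∕(c₀L^{d+1})`, `a = a′ρ`,
`σ = (c₀∕c₁)·ρ²·L^{d+1}`; `Q̃′`, `G′(1)` read exactly as in `B9Eq325ProjFormula.RofU_eq_formula_one`.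
* §1 **`equiv_QGGQ_one_apply`** — THE KERNEL OF `X := Q̃′G′(1)G′(1)Q̃′†`: `(Xψ)(y) = Σ_{y′} (((c₀∕c₁)ρ² : ℂ)·Σ_x conj K_T(x̂,ŷ)·K_T(x̂,ŷ′))•ψ(y′)` (the two outer kernels
  of the prequels composed), **`equiv_QGGQ_one_apply_qggq`** — `= Σ_{y′} ((σ : ℂ)·qggq(L,a,0,m; ŷ, ŷ′))•ψ(y′)` (b05's Gram kernel; box sums = torus sums).
* §2 **`equiv_greenK_QGGQ_one_apply`** — THE KERNEL OF THE INVERSE: for ANY positivity witness `hX` of `X` (e.g. `B9Eq325ProjFormula.QGGQ_pos_one`),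
  `(greenK X hX ψ)(y) = Σ_{y′} ((σ⁻¹ : ℂ)·torusKernel145M(L,a,m; ŷ − ŷ′))•ψ(y′)` — the candidate `Kψ` with that kernel satisfies `X(Kψ) = ψ` by `qggq_conv_torusKernel145M`
  (representatives in the box: divisibility = equality, `dvd_sub_iff_eq_of_mem_box`), and `greenK X (X(Kψ)) = Kψ` (`greenK_apply`).
* §3 **`norm_flatc_le`** — THE DECAY: pv17's bound `‖torusKernel145M(L,a,m;v)‖ ≤ Mc·e^{−κ′·|v|_{T,∞}}` ⟹ `‖σ⁻¹·torusKernel145M(ŷ − ŷ′)‖ ≤ σ⁻¹·Mc·e^{−κ′·d_m(y,y′)}` — the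
  `hc` shape of `B9Eq349KernelConvolutionDecay.block_decay_of_conv3_kernel` (`B9Eq349FlatDGQKernel.tdist_le_torusSupNorm`); **`exists_flatc_bound`** — the VOLUME-free
  package from `inverse145_torusKernelM_decay_torusMetric` BY NAME (`∃ κ′ > 0, K ≥ 0` depending on `d, a₋, a₊` only).
HONEST SCOPE.  Dictionary + decay transfer for the THIRD flat kernel; with the prequels the three factors of print's `P(1) = G′Q′*(Q′G′²Q′*)⁻¹Q′G′` are kernel operators
on the chain's carriers with uniform torus decay BY NAME — the ASSEMBLY `T(1) = D_1(1 − R(1)) = A∗c∗B ⟹ hτ(U ≡ 1)` is the next file, NOT here; flat background ONLY;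
rates are the cell's crude `∃ κ` letters (print's `δ₀`, lens-1's `σ_Z` NOT valued).  NOT NE9 (cell pub-balaban: NE9 NOT PRINTED ∕ NOT PROVED; «NE9 ⇐ the named binders»;
row WALLED ON A MODEL (O-NE9-1; #5 UNRULED); spine PROVED 0∕9; rung (B)+1 on a finite T⁴ — NOT infinite volume, NOT mass gap, NOT Clay; HONEST DEPENDENCY: continuum YM on
T⁴ ⇐ BetaPertH ∧ nine spine estimates (0/9 proved); BetaPertH ⇐ (D1) ∧ (D4) ∧ CAP+tail; G-an2-4 gates asym, D1 and NE2/3/4).  NEW file importing `B9Eq349FlatQGKernel`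
(this seat; ⊇ `B5QGGQ145Torus`, `B5Torus145Decay`); nothing modified.  Net new unproved facts: 0.
-/

noncomputable section

set_option autoImplicit false

open scoped BigOperators InnerProductSpace ComplexConjugate

namespace Literature.MathematicalPhysics.QuantumFieldTheory.Balaban1983to89.B9Eq349FlatQGGQInvKernel

open B4Sect5Torus (TSite tdist)
open B9SectCLatticeCarrier (Bond)
open B9Eq311L2Pairing (WL2)
open B9Eq319QprimeTorus (fineP blockCoord)
open B11Eq103H1Complex (SiteL2K greenK apply_greenK greenK_apply)
open B9Eq326OperatorAssembly (QprimeW)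
open B9Eq3119DeltaPiCarrier (laplacePrimeA GpOfU)
open B9Eq315QTorusOnto (liftSite perSite_liftSite)
open B4TorusPositivity (box)
open B4TorusKernel (periodConst)
open B4TorusKernel.MultiPeriod (torusSupNorm)
open B4TorusGreen244 (KT)
open B5QGGQ145Torus (qggq qggq_conv_torusKernel145M dvd_sub_iff_eq_of_mem_box)
open B5Torus145Decay (torusKernel145M inverse145_torusKernelM_decay_torusMetric)
open B9Eq365QGGQFlatCarrierDictionary (one_le_period sum_box_eq_sum_liftSite liftSite_mem_box)
open B9Eq349FlatDGQKernel (equiv_GpQadj_one_apply tdist_le_torusSupNorm)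
open B9Eq349FlatQGKernel (equiv_QGp_one_apply)

variable {d : ℕ}

section Chain

variable (L : ℕ) [NeZero L] (m : Fin (d + 1) → ℕ) [∀ i, NeZero (m i)] [∀ i, NeZero (fineP L m i)]
  {𝔸 : Type*} [Ring 𝔸] [Algebra ℂ 𝔸] {W : Type*} [NormedAddCommGroup W] [InnerProductSpace ℂ W] [FiniteDimensional ℂ W]
  (φ : W ≃ₗ[ℂ] 𝔸) (c₀ : ℝ) [Fact (0 < c₀)] (η : ℝ) (c₁ : ℝ) [Fact (0 < c₁)]

/-! ## §1 The kernel of `X = Q̃′G′(1)²Q̃′†` is b05's Gram kernel `qggq` -/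

/-- **THE KERNEL OF `Q̃′G′(1)G′(1)Q̃′†`**: `(Xψ)(y) = Σ_{y′} (((c₀∕c₁)ρ²)·Σ_x conj K_T(x̂,ŷ)·K_T(x̂,ŷ′))•ψ(y′)` — the `B`-kernel after the `G′Q̃′†`-kernel.
[cite: Balaban1985BackgroundPropagators, (3.25) p.394; Balaban1984PropagatorsI, (1.44)–(1.45) pp.25–26] -/
theorem equiv_QGGQ_one_apply (hη : η ≠ 0) {a' : ℝ} (ha' : 0 < a')
    (hpos' : ∀ x : SiteL2K ℂ (d + 1) (fineP L m) c₀ W, x ≠ 0 →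
      0 < RCLike.re ⟪x, laplacePrimeA L m φ η (fun _ : Bond (d + 1) (fineP L m) => (1 : 𝔸ˣ)) a' (c₁ := c₁) x⟫_ℂ)
    (ψ : SiteL2K ℂ (d + 1) m c₁ W) (y : TSite (d + 1) m) :
    WL2.equiv ℂ _ W ((((WL2.linearEquiv ℂ ℂ (fun _ : TSite (d + 1) m => c₁)).symm.toLinearMap ∘ₗ
          QprimeW L m φ (fun _ : Bond (d + 1) (fineP L m) => (1 : 𝔸ˣ)) (c₀ := c₀)) ∘ₗ
        GpOfU L m φ η (fun _ : Bond (d + 1) (fineP L m) => (1 : 𝔸ˣ)) a' (c₁ := c₁) hpos' ∘ₗ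
        GpOfU L m φ η (fun _ : Bond (d + 1) (fineP L m) => (1 : 𝔸ˣ)) a' (c₁ := c₁) hpos' ∘ₗ
        LinearMap.adjoint ((WL2.linearEquiv ℂ ℂ (fun _ : TSite (d + 1) m => c₁)).symm.toLinearMap ∘ₗ
          QprimeW L m φ (fun _ : Bond (d + 1) (fineP L m) => (1 : 𝔸ˣ)) (c₀ := c₀))) ψ) y =
      ∑ y' : TSite (d + 1) m, ((((c₀ / c₁ * ((η * L) ^ 2 * (c₁ / (c₀ * (L : ℝ) ^ (d + 1)))) ^ 2) : ℝ) : ℂ) *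
        ∑ x : TSite (d + 1) (fineP L m), conj (KT L (a' * (η * L) ^ 2 * (c₁ / (c₀ * (L : ℝ) ^ (d + 1)))) 0 m (liftSite x) (liftSite y)) * KT L (a' * (η * L) ^ 2 * (c₁ / (c₀ * (L : ℝ) ^ (d + 1)))) 0 m (liftSite x) (liftSite y')) • WL2.equiv ℂ _ W ψ y' := by
  have e1 : (((WL2.linearEquiv ℂ ℂ (fun _ : TSite (d + 1) m => c₁)).symm.toLinearMap ∘ₗ
          QprimeW L m φ (fun _ : Bond (d + 1) (fineP L m) => (1 : 𝔸ˣ)) (c₀ := c₀)) ∘ₗ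
        GpOfU L m φ η (fun _ : Bond (d + 1) (fineP L m) => (1 : 𝔸ˣ)) a' (c₁ := c₁) hpos' ∘ₗ
        GpOfU L m φ η (fun _ : Bond (d + 1) (fineP L m) => (1 : 𝔸ˣ)) a' (c₁ := c₁) hpos' ∘ₗ
        LinearMap.adjoint ((WL2.linearEquiv ℂ ℂ (fun _ : TSite (d + 1) m => c₁)).symm.toLinearMap ∘ₗ
          QprimeW L m φ (fun _ : Bond (d + 1) (fineP L m) => (1 : 𝔸ˣ)) (c₀ := c₀))) ψ =
      ((WL2.linearEquiv ℂ ℂ (fun _ : TSite (d + 1) m => c₁)).symm.toLinearMap ∘ₗ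
          QprimeW L m φ (fun _ : Bond (d + 1) (fineP L m) => (1 : 𝔸ˣ)) (c₀ := c₀))
        (GpOfU L m φ η (fun _ : Bond (d + 1) (fineP L m) => (1 : 𝔸ˣ)) a' (c₁ := c₁) hpos'
          (GpOfU L m φ η (fun _ : Bond (d + 1) (fineP L m) => (1 : 𝔸ˣ)) a' (c₁ := c₁) hpos' (LinearMap.adjoint ((WL2.linearEquiv ℂ ℂ (fun _ : TSite (d + 1) m => c₁)).symm.toLinearMap ∘ₗ
          QprimeW L m φ (fun _ : Bond (d + 1) (fineP L m) => (1 : 𝔸ˣ)) (c₀ := c₀)) ψ))) := rfl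
  rw [e1, equiv_QGp_one_apply L m φ c₀ η c₁ hη ha' hpos' _ y]
  simp only [equiv_GpQadj_one_apply L m φ c₀ η c₁ hη ha' hpos' ψ, Finset.smul_sum, smul_smul]
  rw [Finset.sum_comm]
  refine Finset.sum_congr rfl fun y' _ => ?_
  rw [← Finset.sum_smul, Finset.mul_sum]
  refine congrArg (fun c : ℂ => c • WL2.equiv ℂ _ W ψ y') (Finset.sum_congr rfl fun x _ => ?_)
  push_cast
  ring

/-- **… EQUALS b05's GRAM KERNEL**: `(Xψ)(y) = Σ_{y′} (σ·qggq(L,a,0,m; ŷ, ŷ′))•ψ(y′)`, `σ = (c₀∕c₁)ρ²L^{d+1}` (`qggq = L^{−(d+1)}Σ_{z∈box} conj K_T(z,ŷ)K_T(z,ŷ′)`, box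
sums = torus sums). [cite: Balaban1984PropagatorsI, (1.45) p.26 with p.25; Balaban1985BackgroundPropagators, (3.25) p.394] -/
theorem equiv_QGGQ_one_apply_qggq (hη : η ≠ 0) {a' : ℝ} (ha' : 0 < a')
    (hpos' : ∀ x : SiteL2K ℂ (d + 1) (fineP L m) c₀ W, x ≠ 0 →
      0 < RCLike.re ⟪x, laplacePrimeA L m φ η (fun _ : Bond (d + 1) (fineP L m) => (1 : 𝔸ˣ)) a' (c₁ := c₁) x⟫_ℂ)
    (ψ : SiteL2K ℂ (d + 1) m c₁ W) (y : TSite (d + 1) m) :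
    WL2.equiv ℂ _ W ((((WL2.linearEquiv ℂ ℂ (fun _ : TSite (d + 1) m => c₁)).symm.toLinearMap ∘ₗ
          QprimeW L m φ (fun _ : Bond (d + 1) (fineP L m) => (1 : 𝔸ˣ)) (c₀ := c₀)) ∘ₗ
        GpOfU L m φ η (fun _ : Bond (d + 1) (fineP L m) => (1 : 𝔸ˣ)) a' (c₁ := c₁) hpos' ∘ₗ
        GpOfU L m φ η (fun _ : Bond (d + 1) (fineP L m) => (1 : 𝔸ˣ)) a' (c₁ := c₁) hpos' ∘ₗ
        LinearMap.adjoint ((WL2.linearEquiv ℂ ℂ (fun _ : TSite (d + 1) m => c₁)).symm.toLinearMap ∘ₗ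
          QprimeW L m φ (fun _ : Bond (d + 1) (fineP L m) => (1 : 𝔸ˣ)) (c₀ := c₀))) ψ) y =
      ∑ y' : TSite (d + 1) m, ((((c₀ / c₁ * ((η * L) ^ 2 * (c₁ / (c₀ * (L : ℝ) ^ (d + 1)))) ^ 2 * (L : ℝ) ^ (d + 1)) : ℝ) : ℂ) * qggq L (a' * (η * L) ^ 2 * (c₁ / (c₀ * (L : ℝ) ^ (d + 1)))) 0 m (liftSite y) (liftSite y')) • WL2.equiv ℂ _ W ψ y' := by
  have hL0 : (L : ℂ) ≠ 0 := by exact_mod_cast NeZero.ne L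
  rw [equiv_QGGQ_one_apply L m φ c₀ η c₁ hη ha' hpos' ψ y]
  refine Finset.sum_congr rfl fun y' _ => ?_
  congr 1
  rw [qggq, sum_box_eq_sum_liftSite (fineP L m)]
  have hpow : ((L : ℂ) ^ (d + 1))⁻¹ * (L : ℂ) ^ (d + 1) = 1 := inv_mul_cancel₀ (pow_ne_zero _ hL0)
  have e : (((c₀ / c₁ * ((η * L) ^ 2 * (c₁ / (c₀ * (L : ℝ) ^ (d + 1)))) ^ 2 * (L : ℝ) ^ (d + 1)) : ℝ) : ℂ) = (((c₀ / c₁ * ((η * L) ^ 2 * (c₁ / (c₀ * (L : ℝ) ^ (d + 1)))) ^ 2) : ℝ) : ℂ) * (L : ℂ) ^ (d + 1) := by push_cast; ring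
  rw [e, mul_assoc, mul_assoc, ← mul_assoc ((L : ℂ) ^ (d + 1)), mul_comm ((L : ℂ) ^ (d + 1)), hpow, one_mul]

/-! ## §2 The kernel of the inverse `greenK X` is pv17's `torusKernel145M` -/

/-- **THE KERNEL OF `(Q̃′G′(1)²Q̃′†)⁻¹`**: for ANY positivity witness `hX` of `X = Q̃′G′(1)G′(1)Q̃′†`,
`(greenK X hX ψ)(y) = Σ_{y′} (σ⁻¹·torusKernel145M(L,a,m; ŷ − ŷ′))•ψ(y′)`, `σ = (c₀∕c₁)ρ²L^{d+1}` — b05's `qggq_conv_torusKernel145M` (`X∘K = 1`) and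
`greenK_apply` (`X⁻¹(X(Kψ)) = Kψ`). [cite: Balaban1984PropagatorsI, p.25 («the existence of the inverse operator»), (1.45) p.26; Balaban1985BackgroundPropagators, (3.25) p.394] -/
theorem equiv_greenK_QGGQ_one_apply (hη : η ≠ 0) {a' : ℝ} (ha' : 0 < a')
    (hpos' : ∀ x : SiteL2K ℂ (d + 1) (fineP L m) c₀ W, x ≠ 0 →
      0 < RCLike.re ⟪x, laplacePrimeA L m φ η (fun _ : Bond (d + 1) (fineP L m) => (1 : 𝔸ˣ)) a' (c₁ := c₁) x⟫_ℂ)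
    (hX : ∀ ψ : SiteL2K ℂ (d + 1) m c₁ W, ψ ≠ 0 → 0 < RCLike.re ⟪ψ, (((WL2.linearEquiv ℂ ℂ (fun _ : TSite (d + 1) m => c₁)).symm.toLinearMap ∘ₗ
          QprimeW L m φ (fun _ : Bond (d + 1) (fineP L m) => (1 : 𝔸ˣ)) (c₀ := c₀)) ∘ₗ
        GpOfU L m φ η (fun _ : Bond (d + 1) (fineP L m) => (1 : 𝔸ˣ)) a' (c₁ := c₁) hpos' ∘ₗ
        GpOfU L m φ η (fun _ : Bond (d + 1) (fineP L m) => (1 : 𝔸ˣ)) a' (c₁ := c₁) hpos' ∘ₗ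
        LinearMap.adjoint ((WL2.linearEquiv ℂ ℂ (fun _ : TSite (d + 1) m => c₁)).symm.toLinearMap ∘ₗ
          QprimeW L m φ (fun _ : Bond (d + 1) (fineP L m) => (1 : 𝔸ˣ)) (c₀ := c₀))) ψ⟫_ℂ)
    (ψ : SiteL2K ℂ (d + 1) m c₁ W) (y : TSite (d + 1) m) :
    WL2.equiv ℂ _ W (greenK _ hX ψ) y =
      ∑ y' : TSite (d + 1) m, ((((c₀ / c₁ * ((η * L) ^ 2 * (c₁ / (c₀ * (L : ℝ) ^ (d + 1)))) ^ 2 * (L : ℝ) ^ (d + 1))⁻¹ : ℝ) : ℂ) * torusKernel145M L (a' * (η * L) ^ 2 * (c₁ / (c₀ * (L : ℝ) ^ (d + 1)))) m (liftSite y - liftSite y')) • WL2.equiv ℂ _ W ψ y' := by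
  have hc₀ : 0 < c₀ := Fact.out
  have hc₁ : 0 < c₁ := Fact.out
  have hL0 : (0 : ℝ) < L := by exact_mod_cast Nat.pos_of_ne_zero (NeZero.ne L)
  have hL1 : 1 ≤ L := Nat.one_le_iff_ne_zero.mpr (NeZero.ne L)
  have hm : ∀ i, 1 ≤ m i := one_le_period m
  have hηL : (η * L) ^ 2 ≠ 0 := pow_ne_zero _ (mul_ne_zero hη hL0.ne')
  have hA : 0 < a' * (η * L) ^ 2 * (c₁ / (c₀ * (L : ℝ) ^ (d + 1))) := by
    have : 0 < (η * L) ^ 2 := by positivity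
    positivity
  have hσ : (c₀ / c₁ * ((η * L) ^ 2 * (c₁ / (c₀ * (L : ℝ) ^ (d + 1)))) ^ 2 * (L : ℝ) ^ (d + 1)) ≠ 0 := by
    have h1 : ((η * L) ^ 2 * (c₁ / (c₀ * (L : ℝ) ^ (d + 1)))) ≠ 0 := mul_ne_zero hηL (by positivity)
    positivity
  -- the candidate with pv17's kernel
  set K : SiteL2K ℂ (d + 1) m c₁ W := (WL2.equiv ℂ (fun _ : TSite (d + 1) m => c₁) W).symm
    (fun y => ∑ y' : TSite (d + 1) m, ((((c₀ / c₁ * ((η * L) ^ 2 * (c₁ / (c₀ * (L : ℝ) ^ (d + 1)))) ^ 2 * (L : ℝ) ^ (d + 1))⁻¹ : ℝ) : ℂ) * torusKernel145M L (a' * (η * L) ^ 2 * (c₁ / (c₀ * (L : ℝ) ^ (d + 1)))) m (liftSite y - liftSite y')) • WL2.equiv ℂ _ W ψ y') with hK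
  have hKy : ∀ y', WL2.equiv ℂ _ W K y' =
      ∑ y'' : TSite (d + 1) m, ((((c₀ / c₁ * ((η * L) ^ 2 * (c₁ / (c₀ * (L : ℝ) ^ (d + 1)))) ^ 2 * (L : ℝ) ^ (d + 1))⁻¹ : ℝ) : ℂ) * torusKernel145M L (a' * (η * L) ^ 2 * (c₁ / (c₀ * (L : ℝ) ^ (d + 1)))) m (liftSite y' - liftSite y'')) • WL2.equiv ℂ _ W ψ y'' :=
    fun y' => by rw [hK, Equiv.apply_symm_apply]
  -- each `y''`-coefficient of `X K` is `Σ_{y'} σ·qggq(ŷ₀,ŷ')·σ⁻¹·tK(ŷ' − ŷ'') = δ(y₀, y'')`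
  have hcoef : ∀ y₀ y'' : TSite (d + 1) m,
      (∑ y' : TSite (d + 1) m, (((c₀ / c₁ * ((η * L) ^ 2 * (c₁ / (c₀ * (L : ℝ) ^ (d + 1)))) ^ 2 * (L : ℝ) ^ (d + 1)) : ℝ) : ℂ) * qggq L (a' * (η * L) ^ 2 * (c₁ / (c₀ * (L : ℝ) ^ (d + 1)))) 0 m (liftSite y₀) (liftSite y') *
        ((((c₀ / c₁ * ((η * L) ^ 2 * (c₁ / (c₀ * (L : ℝ) ^ (d + 1)))) ^ 2 * (L : ℝ) ^ (d + 1))⁻¹ : ℝ) : ℂ) * torusKernel145M L (a' * (η * L) ^ 2 * (c₁ / (c₀ * (L : ℝ) ^ (d + 1)))) m (liftSite y' - liftSite y''))) = if y₀ = y'' then 1 else 0 := by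
    intro y₀ y''
    have hσC : (((c₀ / c₁ * ((η * L) ^ 2 * (c₁ / (c₀ * (L : ℝ) ^ (d + 1)))) ^ 2 * (L : ℝ) ^ (d + 1)) : ℝ) : ℂ) * (((c₀ / c₁ * ((η * L) ^ 2 * (c₁ / (c₀ * (L : ℝ) ^ (d + 1)))) ^ 2 * (L : ℝ) ^ (d + 1))⁻¹ : ℝ) : ℂ) = 1 := by
      rw [← Complex.ofReal_mul, mul_inv_cancel₀ hσ, Complex.ofReal_one]
    calc (∑ y' : TSite (d + 1) m, (((c₀ / c₁ * ((η * L) ^ 2 * (c₁ / (c₀ * (L : ℝ) ^ (d + 1)))) ^ 2 * (L : ℝ) ^ (d + 1)) : ℝ) : ℂ) * qggq L (a' * (η * L) ^ 2 * (c₁ / (c₀ * (L : ℝ) ^ (d + 1)))) 0 m (liftSite y₀) (liftSite y') *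
          ((((c₀ / c₁ * ((η * L) ^ 2 * (c₁ / (c₀ * (L : ℝ) ^ (d + 1)))) ^ 2 * (L : ℝ) ^ (d + 1))⁻¹ : ℝ) : ℂ) * torusKernel145M L (a' * (η * L) ^ 2 * (c₁ / (c₀ * (L : ℝ) ^ (d + 1)))) m (liftSite y' - liftSite y'')))
        = ((((c₀ / c₁ * ((η * L) ^ 2 * (c₁ / (c₀ * (L : ℝ) ^ (d + 1)))) ^ 2 * (L : ℝ) ^ (d + 1)) : ℝ) : ℂ) * (((c₀ / c₁ * ((η * L) ^ 2 * (c₁ / (c₀ * (L : ℝ) ^ (d + 1)))) ^ 2 * (L : ℝ) ^ (d + 1))⁻¹ : ℝ) : ℂ)) *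
          ∑ y' : TSite (d + 1) m, qggq L (a' * (η * L) ^ 2 * (c₁ / (c₀ * (L : ℝ) ^ (d + 1)))) 0 m (liftSite y₀) (liftSite y') * torusKernel145M L (a' * (η * L) ^ 2 * (c₁ / (c₀ * (L : ℝ) ^ (d + 1)))) m (liftSite y' - liftSite y'') := by
          rw [Finset.mul_sum]
          exact Finset.sum_congr rfl fun y' _ => by ring
      _ = ∑ y' ∈ box m, qggq L (a' * (η * L) ^ 2 * (c₁ / (c₀ * (L : ℝ) ^ (d + 1)))) 0 m (liftSite y₀) y' * torusKernel145M L (a' * (η * L) ^ 2 * (c₁ / (c₀ * (L : ℝ) ^ (d + 1)))) m (y' - liftSite y'') := by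
          rw [hσC, one_mul, sum_box_eq_sum_liftSite m]
      _ = if y₀ = y'' then 1 else 0 := by
          rw [qggq_conv_torusKernel145M L hL1 _ hA hm (liftSite y₀) (liftSite y'')]
          by_cases h : y₀ = y''
          · subst h
            rw [if_pos rfl, if_pos (fun i => by rw [sub_self]; exact dvd_zero _)]
          · have hne : ¬ (∀ i, ((m i : ℕ) : ℤ) ∣ liftSite y₀ i - liftSite y'' i) := fun hd =>
              h (by
                have e := (dvd_sub_iff_eq_of_mem_box (liftSite_mem_box m y₀) (liftSite_mem_box m y'')).mp hd
                rw [← perSite_liftSite (P := m) y₀, ← perSite_liftSite (P := m) y'', e])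
            rw [if_neg hne, if_neg h]
  -- `X K = ψ`
  have hXK : (((WL2.linearEquiv ℂ ℂ (fun _ : TSite (d + 1) m => c₁)).symm.toLinearMap ∘ₗ
          QprimeW L m φ (fun _ : Bond (d + 1) (fineP L m) => (1 : 𝔸ˣ)) (c₀ := c₀)) ∘ₗ
        GpOfU L m φ η (fun _ : Bond (d + 1) (fineP L m) => (1 : 𝔸ˣ)) a' (c₁ := c₁) hpos' ∘ₗ
        GpOfU L m φ η (fun _ : Bond (d + 1) (fineP L m) => (1 : 𝔸ˣ)) a' (c₁ := c₁) hpos' ∘ₗ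
        LinearMap.adjoint ((WL2.linearEquiv ℂ ℂ (fun _ : TSite (d + 1) m => c₁)).symm.toLinearMap ∘ₗ
          QprimeW L m φ (fun _ : Bond (d + 1) (fineP L m) => (1 : 𝔸ˣ)) (c₀ := c₀))) K = ψ := by
    apply (WL2.equiv ℂ (fun _ : TSite (d + 1) m => c₁) W).injective
    funext y₀
    rw [equiv_QGGQ_one_apply_qggq L m φ c₀ η c₁ hη ha' hpos' K y₀]
    simp only [hKy, Finset.smul_sum, smul_smul]
    rw [Finset.sum_comm]
    simp only [← Finset.sum_smul, hcoef, ite_smul, one_smul, zero_smul, Finset.sum_ite_eq, Finset.mem_univ, if_true]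
  -- `greenK X (X K) = K`
  have h := greenK_apply hX K
  rw [hXK] at h
  rw [h, hKy]

end Chain

/-! ## §3 Decay of the `c`-kernel in the chain's coarse torus metric -/

section Decay

variable (L : ℕ) [NeZero L] (m : Fin (d + 1) → ℕ) [∀ i, NeZero (m i)]

/-- **THE `c`-KERNEL's DECAY**: pv17's bound `‖torusKernel145M(L,a,m;v)‖ ≤ Mc·e^{−κ′·|v|_{T,∞}}` gives `‖τ·torusKernel145M(ŷ − ŷ′)‖ ≤ τ·Mc·e^{−κ′·d_m(y,y′)}` for
`0 ≤ τ` — the `hc` shape of `block_decay_of_conv3_kernel`. [cite: Balaban1984PropagatorsI, (1.45) p.26, p.38; Balaban1985BackgroundPropagators, (3.49) p.399] -/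
theorem norm_flatc_le {a Mc κ' τ : ℝ} (hκ' : 0 ≤ κ') (hτ : 0 ≤ τ)
    (hb : ∀ v : Fin (d + 1) → ℤ, ‖torusKernel145M L a m v‖ ≤ Mc * Real.exp (-(κ' * torusSupNorm m v)))
    (y y' : TSite (d + 1) m) :
    ‖((τ : ℝ) : ℂ) * torusKernel145M L a m (liftSite y - liftSite y')‖ ≤ τ * Mc * Real.exp (-(κ' * tdist m y y')) := by
  have h := hb (liftSite y - liftSite y')
  have hMc : 0 ≤ Mc := le_of_mul_le_mul_right (by rw [zero_mul]; exact (norm_nonneg _).trans h) (Real.exp_pos _)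
  rw [norm_mul, Complex.norm_real, Real.norm_eq_abs, abs_of_nonneg hτ, mul_assoc]
  refine mul_le_mul_of_nonneg_left (h.trans (mul_le_mul_of_nonneg_left (Real.exp_le_exp.mpr ?_) hMc)) hτ
  have := tdist_le_torusSupNorm m y y'
  nlinarith

omit [NeZero L] [∀ i, NeZero (m i)] in
/-- **THE PACKAGE (pv17's (1.45)-inverse decay on the torus, BY NAME)**: for every penalty window `0 < a₋ ≤ a ≤ a₊` there are `κ′ > 0` and `K ≥ 0`, depending on
`d, a₋, a₊` ONLY, such that for EVERY `L`, EVERY volume `m`, every `a` in the window and all `y, y′`: `‖torusKernel145M(L,a,m; ŷ − ŷ′)‖ ≤ K·e^{−κ′·d_m(y,y′)}`.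
[cite: Balaban1984PropagatorsI, (1.45) p.26, (1.126) p.38 («depends on d only»); proof supplied by the audit cell (pv17 ∕ b05), consumed by name] -/
theorem exists_flatc_bound (aminus aplus : ℝ) (ha : 0 < aminus) :
    ∃ κ' K : ℝ, 0 < κ' ∧ 0 ≤ K ∧ ∀ (L : ℕ) [NeZero L] (m : Fin (d + 1) → ℕ) [∀ i, NeZero (m i)] (a : ℝ),
      aminus ≤ a → a ≤ aplus → ∀ (y y' : TSite (d + 1) m),
        ‖torusKernel145M L a m (liftSite y - liftSite y')‖ ≤ K * Real.exp (-(κ' * tdist m y y')) := by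
  obtain ⟨κ, c, hκ, hc, h⟩ := inverse145_torusKernelM_decay_torusMetric d aminus aplus ha
  have hC : 0 ≤ periodConst κ d := by
    unfold periodConst
    refine pow_nonneg (div_nonneg (by positivity) ?_) _
    have hκ' : (0 : ℝ) < κ / (d + 1) := by positivity
    have h1 : Real.exp (-(κ / (d + 1))) < 1 := Real.exp_lt_one_iff.mpr (by linarith)
    linarith
  refine ⟨κ / (d + 1), c⁻¹ * periodConst κ d, by positivity, mul_nonneg (inv_nonneg.mpr hc.le) hC, fun L _ m _ a ha1 ha2 y y' => ?_⟩
  have hm : ∀ i, 1 ≤ m i := one_le_period m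
  have h1 := norm_flatc_le L m (κ' := κ / (d + 1)) (τ := 1) (by positivity) zero_le_one (fun v => h L a ha1 ha2 m hm v) y y'
  rwa [Complex.ofReal_one, one_mul, one_mul] at h1

end Decay

end Literature.MathematicalPhysics.QuantumFieldTheory.Balaban1983to89.B9Eq349FlatQGGQInvKernel

end
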